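import Literature.AlgebraicGeometry.AbelianSchemes.AbelianSchemeDualTransportSlice
import Literature.AlgebraicGeometry.AbelianSchemes.AbelianSchemeKOfL
import Literature.AlgebraicGeometry.Modules.UnitCocyclePresented
import HarnessLib

/-!
# Mumford's bundle and the classification letter along an isomorphism of abelian schemes:
# `(f × f)^*Λ(M) ≅ Λ'(f^*M)` and «`λ` classifies `Λ(M)`» ⟹ «`λ' = e ≫ λ ≫ Ĥ_e⁻¹` classifies `Λ'(e^*M)`»
# ([MumfordFogartyKirwan1994] Ch. 6 §2 Def. 6.2 (p. 120), Ch. 7 §2 Defs. 7.2–7.3 (p. 129) / Prop. 7.3 step (V) (p. 134))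

Layer `Literature/AlgebraicGeometry/AbelianSchemes`, namespace `Literature.AlgebraicGeometry.AbelianSchemes.AbelianSchemeOver`.
THEOREMS ONLY (no definition, no named fact, no instance, no notation, no `sorry`).  Cell `hodgecm-mathlib` (D-0151), F-DAG row
F-6 (H-int): cut of B-p02 (g14) 2026-08-30T10:24:48Z — the letter-transport bricks (T1)+(T2) consumed by the converse half
`MFKSubfunctorOfHilbIntrinsicIff` of the capstone FILE 3 ★ `MFKSubfunctorOfHilbIntrinsic` (§3 «INT(b) ⟹ factorisation»: the
classification letter moves along the rigidity isomorphism `e : A' ≅ A` and its dual transport `Ĥ_e : Â' ≅ Â`); author B-p17 (g14).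
HC_CM is proved only modulo the 7 printed citations until rung 0 closes; nothing here is about HC.

Vocabulary (all ★): ★ `AbelianSchemeKOfL` (`A.mumfordBundle M = m^*M ⊗ (p₁^*M)^∨ ⊗ (p₂^*M)^∨` on `A ×_S A = (A.X ⊗ A.X).left`,
`A.mumfordClass`, `detClass_mumfordBundle`), ★ `AbelianSchemeDualTransport` (`DualPair.hatTransport D D' e : Â' → Â`, its `Over S`
form `hatTransportOver`, the Poincaré clause `nonempty_pullback_map_hatTransport_iso : (e × Ĥ_e)^*𝒫 ≅ 𝒫'`, two-sided inverse
`hatTransport_comp_hatTransport : Ĥ_{e'} ≫ Ĥ_e = 𝟙` for `e' = e⁻¹`), ★ `AbelianSchemeDualTransportSlice`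
(`DualPair.lamTransport D D' e e' λ = e ≫ λ ≫ Ĥ_{e'} : A' → Â'`), determinant classes in `Ȟ¹(–, 𝒪^×)` (★ `detClass`, ★ `CechPic`,
★ `nonempty_iso_iff_detClass_eq`, ★ `detClass_pullback`, ★ `CechPic.pullback_comp`), and Mathlib's cartesian-monoidal `Over S`
(`f ⊗ₘ g`, `X ◁ g`, `f ▷ U`; `IsMonHom.mul_hom : μ' ≫ f = (f ⊗ₘ f) ≫ μ`).

## What is proved
* §1 **`nonempty_pullback_tensorHom_mumfordBundle_iso`** (T1) — for a homomorphism `f : A' → A` of abelian `S`-schemes and a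
  rank-one `M` on `A`: **`(f ⊗ₘ f)^*Λ(M) ≅ Λ'(f^*M)`** («`Λ` is functorial in homomorphisms»: `(f × f) ≫ m = m' ≫ f`,
  `(f × f) ≫ pᵢ = pᵢ' ≫ f`, so both sides have the class `m'^*f^*[M] · (p₁'^*f^*[M])⁻¹ · (p₂'^*f^*[M])⁻¹`; rank-one modules with the
  same class are isomorphic).
* §2 **`forall_nonempty_classify_lamTransport`** (T2) — for dual pairs `D = (Â, 𝒫)`, `D' = (Â', 𝒫')`, an isomorphism of `S`-group
  schemes `e : A' ≅ A` with inverse `e'`, and `λ : A → Â`: if `λ` CLASSIFIES `Λ(M)` in the whisker spelling of ★ α-2′ / ★ (γ)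
  («`(A ◁ (a ≫ λ))^*𝒫 ≅ (A ◁ a)^*Λ(M)` for every point `a : U → A`»), then the transported `λ' = e ≫ λ ≫ Ĥ_{e'} : A' → Â'`
  classifies `Λ'(e^*M)`: for every `a' : U → A'`, **`(A' ◁ (a' ≫ λ'))^*𝒫' ≅ (A' ◁ a')^*Λ'(e^*M)`** — by the Poincaré clause
  `𝒫' ≅ (e × Ĥ_e)^*𝒫`, the interchange `(A' ◁ (a' ≫ λ')) ≫ (e × Ĥ_e) = (e ▷ U) ≫ (A ◁ (a' ≫ e ≫ λ))` (`Ĥ_{e'} ≫ Ĥ_e = 𝟙`), the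
  hypothesis at the point `a' ≫ e` of `A`, the interchange `(e ▷ U) ≫ (A ◁ (a' ≫ e)) = (A' ◁ a') ≫ (e ⊗ₘ e)`, and §1 at `f := e`.
  Auxiliary `Over S` identities: `hatTransportOver_comp_hatTransportOver`, `whiskerLeft_lamTransport_comp_tensorHom`,
  `whiskerRight_comp_whiskerLeft_eq_whiskerLeft_comp_tensorHom`.

## References
* [MumfordFogartyKirwan1994] D. Mumford, J. Fogarty, F. Kirwan, *Geometric Invariant Theory*, 3rd ed. (1994), Ch. 6 §2
  Definition 6.2 (p. 120) (`Λ(L)`), Ch. 7 §2 Definitions 7.2–7.3 (p. 129) (triples up to isomorphism, the Poincaré clause),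
  Proposition 7.3 step (V) (p. 134) (the classification letter).
* [MilneAV2008] J. S. Milne, *Abelian Varieties* (v2.00, 2008), I §8 pp. 36–40 (the dual, `L^* = m^*L ⊗ p^*L⁻¹ ⊗ q^*L⁻¹`).
* [Hartshorne1977] R. Hartshorne, *Algebraic Geometry* (1977), II Ex. 6.8 (a) (pull-back of classes), III Ex. 4.5
  (`Pic ≅ Ȟ¹(𝒪^×)`).
-/

-- `Scheme.Modules` / `SheafOfModules` are not reducible; `(A.X ⊗ B.X).left = A.prodLeft B` holds by `rfl` only
-- (as in ★ `AbelianSchemeKOfL`, ★ `NormalisedBundleBaseChange`).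
set_option backward.isDefEq.respectTransparency false

noncomputable section

open CategoryTheory CategoryTheory.Limits AlgebraicGeometry MonoidalCategory CartesianMonoidalCategory
open scoped MonObj

universe u

namespace Literature.AlgebraicGeometry.AbelianSchemes

open Literature.AlgebraicGeometry.Motives Literature.AlgebraicGeometry.Modules
  Literature.AlgebraicGeometry.AbelianVarieties

namespace AbelianSchemeOver

variable {S : Scheme.{u}} {A A' : AbelianSchemeOver S}

/-! ## §1 (T1) Mumford's bundle is functorial in homomorphisms: `(f × f)^*Λ(M) ≅ Λ'(f^*M)` -/

/-- **`(f ⊗ₘ f)^*Λ(M) ≅ Λ'(f^*M)`** for a homomorphism `f : A' → A` of abelian `S`-schemes (`[IsMonHom f]`) and a rank-one `M` on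
`A` — Mumford's `Λ` ([MumfordFogartyKirwan1994] Ch. 6 §2 Def. 6.2: «`μ^*(L) ⊗ p₁^*(L)⁻¹ ⊗ p₂^*(L)⁻¹` on `X ×_S X`») is functorial in
homomorphisms.  Class road in `Ȟ¹(A' ×_S A', 𝒪^×)`: `[(f ⊗ₘ f)^*Λ(M)] = (f ⊗ₘ f)^*Λ([M])` (★ `detClass_pullback`, ★ `detClass_mumfordBundle`)
`= ((f ⊗ₘ f) ≫ m)^*[M] · (((f ⊗ₘ f) ≫ p₁)^*[M])⁻¹ · (((f ⊗ₘ f) ≫ p₂)^*[M])⁻¹` (★ `CechPic.pullback_comp`) and `(f ⊗ₘ f) ≫ m = m' ≫ f`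
(`IsMonHom.mul_hom`), `(f ⊗ₘ f) ≫ pᵢ = pᵢ' ≫ f` (`tensorHom_fst`/`tensorHom_snd`), which is `Λ'([f^*M]) = [Λ'(f^*M)]`; rank-one
modules with equal classes are isomorphic (★ `nonempty_iso_iff_detClass_eq`). [cite: MumfordFogartyKirwan1994, Ch. 6 §2 Definition 6.2 (p. 120)]
[cite: MilneAV2008, I §8 (p. 40)] [cite: Hartshorne1977, III Ex. 4.5] -/
theorem nonempty_pullback_tensorHom_mumfordBundle_iso (f : A'.X ⟶ A.X) [IsMonHom f] {M : A.left.Modules}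
    (hM : HasRank M 1) :
    Nonempty ((Scheme.Modules.pullback (f ⊗ₘ f).left).obj (A.mumfordBundle M) ≅
      A'.mumfordBundle ((Scheme.Modules.pullback f.left).obj M)) := by
  -- ranks
  have hΛ : HasRank (A.mumfordBundle M) 1 := A.hasRank_mumfordBundle hM
  have hΛf : HasRank ((Scheme.Modules.pullback (X := (A'.X ⊗ A'.X).left) (f ⊗ₘ f).left).obj (A.mumfordBundle M)) 1 :=
    hasRank_pullback _ hΛ
  have hMf : HasRank ((Scheme.Modules.pullback f.left).obj M) 1 := hasRank_pullback _ hM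
  have hΛ' : HasRank (A'.mumfordBundle ((Scheme.Modules.pullback f.left).obj M)) 1 := A'.hasRank_mumfordBundle hMf
  let fM := HasRank.isFiniteLocallyFree' hM
  let fΛ := HasRank.isFiniteLocallyFree' hΛ
  let fΛf := HasRank.isFiniteLocallyFree' hΛf
  let fMf := HasRank.isFiniteLocallyFree' hMf
  let fΛ' := HasRank.isFiniteLocallyFree' hΛ'
  -- the class of `f^*M`
  have hMfc : detClass fMf = CechPic.pullback f.left (detClass fM) :=
    (detClass_eq_of_iso (Iso.refl _) fMf (fM.pullback _)).trans (detClass_pullback _ fM)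
  -- the class of `(f ⊗ₘ f)^*Λ(M)`
  have hΛfc : detClass fΛf = CechPic.pullback (X := (A'.X ⊗ A'.X).left) (f ⊗ₘ f).left (detClass fΛ) :=
    (detClass_eq_of_iso (Iso.refl _) fΛf (fΛ.pullback _)).trans (detClass_pullback _ fΛ)
  refine (nonempty_iso_iff_detClass_eq hΛf hΛ' fΛf fΛ').2 ?_
  rw [hΛfc, A.detClass_mumfordBundle hM fΛ, A'.detClass_mumfordBundle hMf fΛ', hMfc]
  -- `(f ⊗ₘ f)^*Λ(c) = Λ'(f^*c)` in `Ȟ¹(A' ×_S A', 𝒪^×)`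
  simp only [mumfordClass, map_mul, map_inv, ← CechPic.pullback_comp, ← Over.comp_left]
  rw [tensorHom_fst, tensorHom_snd, ← IsMonHom.mul_hom f]

/-! ## §2 (T2) The classification letter moves along `(e, Ĥ_e)`: `λ' = e ≫ λ ≫ Ĥ_{e'}` classifies `Λ'(e^*M)` -/

namespace DualPair

variable (D : A.DualPair) (D' : A'.DualPair) (e : A'.X ≅ A.X) [IsMonHom e.hom] (e' : A.X ≅ A'.X) [IsMonHom e'.hom]

/-- **`Ĥ_{e'} ≫ Ĥ_e = 𝟙_Â` in `Over S`** for `e' = e⁻¹` (★ `hatTransport_comp_hatTransport` on underlying schemes).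
[cite: MilneAV2008, I §8 pp. 36–37] -/
theorem hatTransportOver_comp_hatTransportOver (he' : e'.hom = e.inv) :
    hatTransportOver D' D e' ≫ hatTransportOver D D' e = 𝟙 D.hat.X :=
  Over.OverMorphism.ext (by
    rw [Over.comp_left, hatTransportOver_left, hatTransportOver_left, Over.id_left]
    exact hatTransport_comp_hatTransport D D' e e' he')

/-- **The first interchange**: `(A' ◁ (a' ≫ λ')) ≫ (e ⊗ₘ Ĥ_e) = (e ▷ U) ≫ (A ◁ ((a' ≫ e) ≫ λ))` in `Over S`, for
`λ' = e ≫ λ ≫ Ĥ_{e'}` and `e' = e⁻¹` (both have the components `p_{A'} ≫ e` and `p_U ≫ a' ≫ e ≫ λ`, since `Ĥ_{e'} ≫ Ĥ_e = 𝟙`).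
[cite: MumfordFogartyKirwan1994, Ch. 7 §2 Definitions 7.2–7.3 (p. 129)] -/
theorem whiskerLeft_lamTransport_comp_tensorHom (he' : e'.hom = e.inv) (lam : A.X ⟶ D.hat.X) {U : Over S}
    (a' : U ⟶ A'.X) :
    (A'.X ◁ (a' ≫ lamTransport D D' e e' lam)) ≫ (e.hom ⊗ₘ hatTransportOver D D' e) =
      (e.hom ▷ U) ≫ (A.X ◁ ((a' ≫ e.hom) ≫ lam)) := by
  have hH := hatTransportOver_comp_hatTransportOver D D' e e' he'
  apply CartesianMonoidalCategory.hom_ext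
  · simp only [Category.assoc, tensorHom_fst, whiskerLeft_fst_assoc, whiskerLeft_fst, whiskerRight_fst]
  · simp only [lamTransport, Category.assoc, tensorHom_snd, whiskerLeft_snd_assoc, whiskerLeft_snd, whiskerRight_snd_assoc,
      hH, Category.comp_id]

end DualPair

/-- **The second interchange**: `(e ▷ U) ≫ (A ◁ (a' ≫ e)) = (A' ◁ a') ≫ (e ⊗ₘ e)` in `Over S` (both are `e ⊗ₘ (a' ≫ e)`).
[cite: MumfordFogartyKirwan1994, Ch. 7 §2 Definitions 7.2–7.3 (p. 129)] -/
theorem whiskerRight_comp_whiskerLeft_eq_whiskerLeft_comp_tensorHom (f : A'.X ⟶ A.X) {U : Over S} (a' : U ⟶ A'.X) :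
    (f ▷ U) ≫ (A.X ◁ (a' ≫ f)) = (A'.X ◁ a') ≫ (f ⊗ₘ f) := by
  apply CartesianMonoidalCategory.hom_ext
  · simp only [Category.assoc, whiskerLeft_fst, whiskerRight_fst, tensorHom_fst, whiskerLeft_fst_assoc]
  · simp only [Category.assoc, whiskerLeft_snd, whiskerRight_snd_assoc, tensorHom_snd, whiskerLeft_snd_assoc]

/-- **The classification letter moves along `(e, Ĥ_e)`** ([MumfordFogartyKirwan1994] Ch. 7 §2 Prop. 7.3 step (V) «the closed
subscheme where `λ` classifies `Λ(L′)`», transported through an isomorphism of triples, Defs. 7.2–7.3): for dual pairs `D = (Â, 𝒫)` of `A`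
and `D' = (Â', 𝒫')` of `A'`, an isomorphism of `S`-group schemes `e : A' ≅ A` with inverse `e'` (`e'.hom = e.inv`), `λ : A → Â` over
`S` and a rank-one `M` on `A`: if `(A ◁ (a ≫ λ))^*𝒫 ≅ (A ◁ a)^*Λ(M)` for every `S`-scheme `U` and every point `a : U → A`, then for
the transported `λ' := e ≫ λ ≫ Ĥ_{e'} : A' → Â'` (★ `DualPair.lamTransport`) and every point `a' : U → A'`,
**`(A' ◁ (a' ≫ λ'))^*𝒫' ≅ (A' ◁ a')^*Λ'(e^*M)`**.  Proof: `𝒫' ≅ (e ⊗ₘ Ĥ_e)^*𝒫` (★ `nonempty_pullback_map_hatTransport_iso`), the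
interchange `(A' ◁ (a' ≫ λ')) ≫ (e ⊗ₘ Ĥ_e) = (e ▷ U) ≫ (A ◁ ((a' ≫ e) ≫ λ))` (`Ĥ_{e'} ≫ Ĥ_e = 𝟙`), the hypothesis at the point
`a' ≫ e` of `A`, the interchange `(e ▷ U) ≫ (A ◁ (a' ≫ e)) = (A' ◁ a') ≫ (e ⊗ₘ e)`, and §1 `(e ⊗ₘ e)^*Λ(M) ≅ Λ'(e^*M)`.
[cite: MumfordFogartyKirwan1994, Ch. 7 §2 Definitions 7.2–7.3 (p. 129)] [cite: MumfordFogartyKirwan1994, Ch. 7 §2 Proposition 7.3 (pp. 132–134)]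
[cite: MilneAV2008, I §8 pp. 36–37] -/
theorem forall_nonempty_classify_lamTransport (D : A.DualPair) (D' : A'.DualPair) (e : A'.X ≅ A.X) [IsMonHom e.hom]
    (e' : A.X ≅ A'.X) [IsMonHom e'.hom] (he' : e'.hom = e.inv) (lam : A.X ⟶ D.hat.X) {M : A.left.Modules} (hM : HasRank M 1)
    (h : ∀ ⦃U : Over S⦄ (a : U ⟶ A.X),
      Nonempty ((Scheme.Modules.pullback (A.X ◁ (a ≫ lam)).left).obj D.P ≅
        (Scheme.Modules.pullback (A.X ◁ a).left).obj (A.mumfordBundle M)))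
    ⦃U : Over S⦄ (a' : U ⟶ A'.X) :
    Nonempty ((Scheme.Modules.pullback (A'.X ◁ (a' ≫ DualPair.lamTransport D D' e e' lam)).left).obj D'.P ≅
      (Scheme.Modules.pullback (A'.X ◁ a').left).obj (A'.mumfordBundle ((Scheme.Modules.pullback e.hom.left).obj M))) := by
  obtain ⟨i⟩ := DualPair.nonempty_pullback_map_hatTransport_iso D D' e
  obtain ⟨j⟩ := h (a' ≫ e.hom)
  obtain ⟨k⟩ := nonempty_pullback_tensorHom_mumfordBundle_iso (A := A) (A' := A') e.hom hM
  -- the two interchanges on underlying schemes (`(e ⊗ₘ Ĥ_e).left` is the `pullback.map` of the Poincaré clause by `rfl`)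
  have E1 : (A'.X ◁ (a' ≫ DualPair.lamTransport D D' e e' lam)).left ≫
      pullback.map A'.X.hom D'.hat.X.hom A.X.hom D.hat.X.hom e.hom.left (DualPair.hatTransport D D' e) (𝟙 S)
        (by rw [Category.comp_id, Over.w e.hom]) (by rw [Category.comp_id, DualPair.hatTransport_comp_hom]) =
      (e.hom ▷ U).left ≫ (A.X ◁ ((a' ≫ e.hom) ≫ lam)).left := by
    rw [← Over.comp_left, ← DualPair.whiskerLeft_lamTransport_comp_tensorHom D D' e e' he' lam a', Over.comp_left]
    rfl
  have E2 : (e.hom ▷ U).left ≫ (A.X ◁ (a' ≫ e.hom)).left = (A'.X ◁ a').left ≫ (e.hom ⊗ₘ e.hom).left := by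
    rw [← Over.comp_left, ← Over.comp_left, whiskerRight_comp_whiskerLeft_eq_whiskerLeft_comp_tensorHom e.hom a']
  exact ⟨(Scheme.Modules.pullback (A'.X ◁ (a' ≫ DualPair.lamTransport D D' e e' lam)).left).mapIso i.symm ≪≫
    (Scheme.Modules.pullbackComp _ _).app D.P ≪≫
    (Scheme.Modules.pullbackCongr E1).app D.P ≪≫
    ((Scheme.Modules.pullbackComp (e.hom ▷ U).left (A.X ◁ ((a' ≫ e.hom) ≫ lam)).left).app D.P).symm ≪≫
    (Scheme.Modules.pullback (e.hom ▷ U).left).mapIso j ≪≫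
    (Scheme.Modules.pullbackComp (e.hom ▷ U).left (A.X ◁ (a' ≫ e.hom)).left).app (A.mumfordBundle M) ≪≫
    (Scheme.Modules.pullbackCongr E2).app (A.mumfordBundle M) ≪≫
    ((Scheme.Modules.pullbackComp (A'.X ◁ a').left (e.hom ⊗ₘ e.hom).left).app (A.mumfordBundle M)).symm ≪≫
    (Scheme.Modules.pullback (A'.X ◁ a').left).mapIso k⟩

end AbelianSchemeOver

end Literature.AlgebraicGeometry.AbelianSchemes

end
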